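import Mathlib
import Summits.AtomisticToContinuum.HydrodynamicLimit.Theorems.ImplosionDichotomyDenseExcursionSonicCavityDefs

/-!
# The Frobenius exponent of the smooth branch at the sonic point (crux `DenseExcursion`, line `sonic-cavity-renewal`)

Helper file (`--supports stmt-AtomisticToContinuum-12586`, line lead a2, stub-worker for `stub_cavityResolvent`).

Write the resolvent equation `(Λ − L)(ŵ, ŝ) = (f, g)`, `L = (linW, linS)` (`…R2Modes`), in the characteristic fields
`p = ŵ + 3ŝ`, `q = ŵ − 3ŝ` of the principal symbol (`lin_characteristic_rows`, `…SonicConfinementOrderZero`): the `p`-row is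
`(W + S − 1)·p′ = (Λ − b)·p − b_{pq}·q − (f + 3g)` with the ORDER-0 COEFFICIENT OF THE DEGENERATE FIELD
`b(x) = (2/3)W′ + 2S′ + 2W + 4S − r` (`= ℓ₊ B r₊`, `ℓ₊ = (1,3)`, `r₊ = (1/2, 1/6)`). At the sonic point `x = 0` of the cavity
tube (`W(0) + S(0) = 1`, `W + S − 1 ≈ −κx`, `κ = −(W′ + S′)(0) ≥ 2/5`) the `p`-row is the Euler equation
`−κ x p′ = (Λ − b(0)) p + …`, whose non-analytic local solution is `|x|^{ν(Λ)}` with the FROBENIUS EXPONENT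
`ν(Λ) = (b(0) − Λ)/κ`. This file computes `b(0)` from the stub's hypotheses:

* `sonic_order_zero_coefficient` (registered helper): under `IsMonatomicProfile`, `OrigProfileEqs`, `CavityTube` and
  `r ≤ 89409/80000`: `b(0) = 4 − 2r − κ` (mass equation at the sonic point: `S′(0) − W′(0)/3 = 2W(0) − r`), the tube bounds
  `2/5 ≤ κ ≤ 7/4`, and hence `b(0) + 1/5 = 4 + 1/5 − 2r − κ > 0`, i.e. `Re ν(Λ) = (b(0) − Re Λ)/κ > 0` on the whole closed
  half-plane `Re Λ ≥ −1/5` left of `b(0)` — in particular along the Laplace-inversion line `Re Λ = −1/5`, where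
  `Re ν = (4 + 1/5 − 2r − κ)/κ ∈ (0, 4)` (on `SS(r₂)`: `b(0) = 1.3622`, `κ = 0.41218`, `ν(−1/5) = 3.79`, `ν(−0.2865) = 4`).

Consequence recorded in the worker report (not formalised): since `Re ν(Λ) > 0`, the smooth branch at the repulsive sonic point is
selected by `⌈Re ν⌉` Taylor conditions and the smooth solution operator is NOT bounded from weighted `C⁰` to weighted `C⁰`
(mollified finitely-regular modes `u_ε` give smooth compactly supported sources `(Λ − L)u_ε = O(ε^{Re ν})` in sup norm with
`‖u_ε‖_sup → ‖u_hom‖_sup > 0`), so the existence-with-bound half of `CavityResolvent` must measure the source in weighted `C^k`,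
`k > Re ν(−1/5)`, i.e. `k ≥ 4` given `κ ≥ 2/5` and the window (`ν(−1/5) ≤ (4.2 − 2·17307/15625 − 2/5)/(2/5) < 4`).
-/

noncomputable section

namespace Summit.AtomisticToContinuum.HydrodynamicLimit.Theorems.SonicCavityRenewal

open Summit.AtomisticToContinuum.HydrodynamicLimit.Theorems.R2OneModeTwoConditions

/-- The mass equation AT THE SONIC POINT: if `W 0 + S 0 = 1`, `S 0 > 0` and the mass equation
`(1 − W)S′ − (S/3)W′ = S(2W − r)` holds at `0`, then `S′(0) − W′(0)/3 = 2W(0) − r`. [folklore] -/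
theorem sonic_mass_relation {r : ℝ} {W S : ℝ → ℝ} (h0 : W 0 + S 0 = 1) (hS : 0 < S 0)
    (hC : (1 - W 0) * deriv S 0 - S 0 / 3 * deriv W 0 = S 0 * (2 * W 0 - r)) :
    deriv S 0 - deriv W 0 / 3 = 2 * W 0 - r := by
  have h1 : 1 - W 0 = S 0 := by linarith
  rw [h1] at hC
  have h2 : S 0 * (deriv S 0 - deriv W 0 / 3 - (2 * W 0 - r)) = 0 := by linear_combination hC
  rcases mul_eq_zero.1 h2 with h | h
  · exact absurd h hS.ne'
  · linarith

/-- **Registered helper `sonic_order_zero_coefficient`: THE ORDER-0 COEFFICIENT OF THE DEGENERATE CHARACTERISTIC FIELD AT THE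
SONIC POINT.** Under the stub's hypotheses (`IsMonatomicProfile`, `OrigProfileEqs`, `CavityTube`, `r ≤ 89409/80000`), with
`κ = −(W′(0) + S′(0))` the repulsivity: `b(0) = (2/3)W′(0) + 2S′(0) + 2W(0) + 4S(0) − r = 4 − 2r − κ`, `2/5 ≤ κ ≤ 7/4`, and
`4 + 1/5 − 2r − κ > 0` — so the Frobenius exponent `ν(Λ) = (b(0) − Λ)/κ` of the smooth branch has `Re ν > 0` on
`−1/5 ≤ Re Λ < b(0)`. [folklore] -/
theorem sonic_order_zero_coefficient : ∀ (r : ℝ) (W S : ℝ → ℝ), r ≤ 89409 / 80000 → IsMonatomicProfile r W S → OrigProfileEqs r W S → CavityTube r W S → 2 / 3 * deriv W 0 + 2 * deriv S 0 + 2 * W 0 + 4 * S 0 - r = 4 - 2 * r - (-(deriv W 0 + deriv S 0)) ∧ (2 / 5 ≤ -(deriv W 0 + deriv S 0) ∧ -(deriv W 0 + deriv S 0) ≤ 7 / 4) ∧ 0 < 4 + 1 / 5 - 2 * r - (-(deriv W 0 + deriv S 0)) := by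
  intro r W S hr9 hP hE hT
  obtain ⟨-, -, -, hS, hSpos, -⟩ := hP
  obtain ⟨h0, -, -, -, hκ, -, -, hWc, hSc, -⟩ := hT
  obtain ⟨-, hW1, -⟩ := hWc 0 zero_le_one
  obtain ⟨-, hS0, hS1, -⟩ := hSc 0 zero_le_one
  have hmass : deriv S 0 - deriv W 0 / 3 = 2 * W 0 - r := sonic_mass_relation h0 (hSpos 0) (hE 0).2
  -- the derivative of `eˣ S` at `0` is `S 0 + S′ 0`
  have hd : deriv (fun y => Real.exp y * S y) 0 = S 0 + deriv S 0 := by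
    have hSd : DifferentiableAt ℝ S 0 := (hS.differentiable (by simp)) 0
    rw [deriv_fun_mul (Real.differentiable_exp 0) hSd, Real.deriv_exp, Real.exp_zero]
    ring
  rw [hd] at hS1
  rw [Real.exp_zero, one_mul] at hS0
  have hW1' := (abs_le.1 hW1).1
  have hS1' := (abs_le.1 hS1).1
  have hκ' : -(deriv W 0 + deriv S 0) ≤ 7 / 4 := by linarith
  exact ⟨by linear_combination hmass + 4 * h0, ⟨by linarith, hκ'⟩, by linarith⟩

end Summit.AtomisticToContinuum.HydrodynamicLimit.Theorems.SonicCavityRenewal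

end
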